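import Literature.Analysis.OperatorTheory.ContractiveDeterminantalRepresentation
import Mathlib.Algebra.MvPolynomial.NoZeroDivisors
import Mathlib.Analysis.InnerProductSpace.Adjoint
import Mathlib.RingTheory.Polynomial.UniqueFactorization
import HarnessLib

/-!
# Proof of Grinshpan–Kaliuzhnyi-Verbovetskyi–Woerdeman, Theorem 5.6
# (`GKVW2012_thm_5_6_holds`)

Discharges the named fact `Literature.Analysis.OperatorTheory.GKVW2012_thm_5_6` of
`Literature/Analysis/OperatorTheory/ContractiveDeterminantalRepresentation.lean` (statement,
vocabulary and conventions there; nothing is restated here).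

Source (read, arXiv text page-checked): A. Grinshpan, D. S. Kaliuzhnyi-Verbovetskyi,
H. J. Woerdeman, *Norm-constrained determinantal representations of multivariable polynomials*,
Complex Anal. Oper. Theory 7 (2013) 635–654 = arXiv:1208.2288
[GrinshpanKaliuzhnyiverbovetsWoerdeman2012], Theorem 5.6 (p. 10) and its proof (p. 10–11),
Lemma 2.2 (p. 5, Schur complement: "if `det D ≠ 0`, then `det P = det D det(A − B D⁻¹ C)`").

**The published proof, verbatim in outline** (p. 10–11). "Taking the determinant of both sides of
`z^m p̄(1/z)/p(z) = A + B Z_m (I − D Z_m)⁻¹ C` and using Lemma 2.2, we obtain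
`z^m p̄(1/z)/p(z) = det [[A, −B Z_m], [C, I − D Z_m]] / det(I − D Z_m) =: r(z)/s(z)`. Note that
both `r(z)` and `s(z)` are of degree at most `m`. We now obtain that `(z^m p̄(1/z)) s(z) = r(z) p(z)`.
As `p` is scattering Schur we must have that `p(z)` divides `s(z)`, say `s(z) = q(z) p(z)`.
Dividing out `p(z)` …, `(z^m p̄(1/z)) q(z) = r(z)`. As the left hand side has degree `m + deg q`
and the right hand side degree at most `m`, we obtain that `q` must be a constant. But then, using
`p(0) = 1` and `s(0) = det(I − D Z_m)|_{z=0} = 1`, we obtain that `q = 1`, and thus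
`p(z) = det(I − K Z_m)` with `K = D`."

**Formalization** (same steps, same order; Mathlib supplies the UFD `ℂ[z]`, `degrees`, and the
isometry of unitaries):
* `det_fromBlocks_mul_det` — Lemma 2.2 for a `1 × 1` corner with denominators cleared
  (`D⁻¹ = adj D / det D`), valid over any commutative ring, so that it applies in `ℂ[z]`;
  `IsRealizedBy.mul_gkvwDet_eq` — `z^m p̄(1/z) · s = p · r`;
* `degrees_det_le_sum`, `degrees_det_numMatrix_le` — "`r` (and `s`) of degree at most `m`",
  column by column;
* `p ∣ s`: `p(0) = 1` makes `p` coprime to `z^{m − deg p}` (Mathlib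
  `MvPolynomial.dvd_monomial_mul_iff_exists`), and scattering Schur (`IsRelPrime p (z^{deg p} p̄(1/z))`)
  gives `p ∣ s` by `IsRelPrime.dvd_of_dvd_mul_left` (`ℂ[z]` is a UFD, hence a decomposition
  monoid); `conjReverse_eq_monomial_mul` is `z^m p̄(1/z) = z^{m − deg p} · z^{deg p} p̄(1/z)`;
* degree count: `coeff_conjReverse_self` (the `z^m`-coefficient of `z^m p̄(1/z)` is
  `conj p(0) = 1`, so its degree is exactly `m`), Mathlib `MvPolynomial.degrees_mul_eq`,
  `totalDegree_eq_zero_iff_eq_C`; `constantCoeff_gkvwDet` is `s(0) = 1`;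
* `isContraction_toBlocks₂₂` — `K = D` is a contraction: `‖D x‖ ≤ ‖U (0 ⊕ x)‖ = ‖x‖` for the
  unitary `U` (Mathlib `ContinuousLinearMap.norm_map_of_mem_unitary`); the source takes this for
  granted ("with `K = D`").
The extra hypothesis "every exponent of `p` is `≤ m`" of the vendored statement is used exactly
where the source uses it implicitly (to write `z^m p̄(1/z)` as a polynomial and split off
`z^{m − deg p}`).
-/

noncomputable section

namespace Literature.Analysis.OperatorTheory

open MvPolynomial Matrix

variable {σ : Type*} {R : ℕ}

/-! ## Proof of Theorem 5.6 (`GKVW2012_thm_5_6_holds`)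

We follow [GKVW, proof of Thm. 5.6, p. 10–11]: with `U = [[A, B], [C, D]]` realizing
`z^m p̄(1/z)/p`, Lemma 2.2 gives `z^m p̄(1/z)/p = r/s`, `r = det [[A, −B Z_m], [C, I − D Z_m]]`,
`s = det(I − D Z_m)`, both of degree `≤ m`; `p` scattering Schur forces `p ∣ s`, `s = q p`; then
`z^m p̄(1/z) q = r` has degree `m + deg q ≤ m`, so `q` is constant, `= 1` by `p(0) = s(0) = 1`;
hence `p = det(I − K Z_m)` with `K = D`, a corner of the unitary `U`, so a contraction. The helper
lemmas below are these steps, in this order of use. -/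

/-- **[GKVW, Lemma 2.2] (Schur complement), adjugate form.** For a block matrix with a `1 × 1`
corner `A`, `det [[A, B], [C, D]] · det D = (A · det D − B · adj(D) · C) · det D` over any
commutative ring (Lemma 2.2 reads `det P = det D · det(A − B D⁻¹ C)` when `det D ≠ 0`; here the
denominator is cleared with `D⁻¹ = adj(D)/det D`, which is the form used in the proof of Thm. 5.6).
[cite: GrinshpanKaliuzhnyiverbovetsWoerdeman2012, Lemma 2.2] -/
theorem det_fromBlocks_mul_det {S : Type*} [CommRing S] {n : Type*} [Fintype n] [DecidableEq n]
    (A : Matrix (Fin 1) (Fin 1) S) (B : Matrix (Fin 1) n S) (C : Matrix n (Fin 1) S)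
    (D : Matrix n n S) :
    (fromBlocks A B C D).det * D.det = (A 0 0 * D.det - (B * D.adjugate * C) 0 0) * D.det := by
  have key : fromBlocks A B C D * fromBlocks (D.det • (1 : Matrix (Fin 1) (Fin 1) S)) 0
      (-(D.adjugate * C)) 1 = fromBlocks (D.det • A - B * D.adjugate * C) B 0 D := by
    rw [fromBlocks_multiply]
    congr 1
    · rw [Matrix.mul_smul, Matrix.mul_one, Matrix.mul_neg, Matrix.mul_assoc, sub_eq_add_neg]
    · rw [Matrix.mul_zero, Matrix.mul_one, zero_add]
    · rw [Matrix.mul_smul, Matrix.mul_one, Matrix.mul_neg, ← Matrix.mul_assoc, mul_adjugate,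
        Matrix.smul_mul, Matrix.one_mul, add_neg_cancel]
    · rw [Matrix.mul_zero, Matrix.mul_one, zero_add]
  have hdet := congrArg Matrix.det key
  rw [det_mul, det_fromBlocks_zero₁₂, det_fromBlocks_zero₂₁, det_one, mul_one, det_fin_one,
    det_fin_one] at hdet
  have h1 : (D.det • (1 : Matrix (Fin 1) (Fin 1) S)) 0 0 = D.det := by simp
  have h2 : (D.det • A - B * D.adjugate * C) 0 0 = A 0 0 * D.det - (B * D.adjugate * C) 0 0 := by
    simp [Matrix.sub_apply, mul_comm]
  rw [h1, h2] at hdet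
  exact hdet

/-- Column-by-column degree bound for a determinant with polynomial entries: if every entry of
column `j` of `M` has degrees `≤ τ j`, then `deg (det M) ≤ Σ_j τ j` (expand `det` as a signed sum
over permutations). This is the step "both `r(z)` and `s(z)` are of degree at most `m`" in the
proof of [GKVW, Thm. 5.6]. [folklore] -/
theorem degrees_det_le_sum {S : Type*} [CommRing S] {ι : Type*} [Fintype ι] [DecidableEq ι]
    [DecidableEq σ] (M : Matrix ι ι (MvPolynomial σ S)) (τ : ι → Multiset σ)
    (h : ∀ i j, (M i j).degrees ≤ τ j) : M.det.degrees ≤ ∑ j, τ j := by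
  rw [det_apply]
  refine (degrees_sum_le _ _).trans (Finset.sup_le fun π _ => ?_)
  have hprod : (∏ i, M (π i) i).degrees ≤ ∑ j, τ j :=
    degrees_prod_le.trans (Finset.sum_le_sum fun i _ => h (π i) i)
  rcases Int.units_eq_one_or (Equiv.Perm.sign π) with hs | hs
  · rw [hs, one_smul]; exact hprod
  · rw [hs, Units.neg_smul, one_smul, degrees_neg]; exact hprod

/-- `toMultiset` is monotone (order isomorphism `Finsupp.orderIsoMultiset`). [folklore] -/
theorem toMultiset_le_toMultiset [DecidableEq σ] {a b : σ →₀ ℕ} :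
    Finsupp.toMultiset a ≤ Finsupp.toMultiset b ↔ a ≤ b := by
  rw [← Finsupp.coe_orderIsoMultiset, OrderIso.le_iff_le]

/-- The multidegree of the numerator determinant `r(z) = det [[A, −B Z_m], [C, I − D Z_m]]` of
[GKVW, proof of Thm. 5.6] is at most `m`: column `j` of the `Z_m`-part only involves `z_{κ j}`,
linearly. [cite: GrinshpanKaliuzhnyiverbovetsWoerdeman2012, proof of Thm. 5.6] -/
theorem degrees_det_numMatrix_le [DecidableEq σ] (κ : Fin R → σ) (A : Matrix (Fin 1) (Fin 1) ℂ)
    (B : Matrix (Fin 1) (Fin R) ℂ) (C' : Matrix (Fin R) (Fin 1) ℂ) (D : Matrix (Fin R) (Fin R) ℂ) :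
    (fromBlocks (A.map C) (-(B.map C * blockVar κ)) (C'.map C)
        (1 - D.map C * blockVar κ)).det.degrees ≤ Finsupp.toMultiset (blockOrder κ) := by
  have hτ : Finsupp.toMultiset (blockOrder κ) =
      ∑ j : Fin 1 ⊕ Fin R, Sum.elim (fun _ => (0 : Multiset σ)) (fun j => {κ j}) j := by
    rw [blockOrder, Finsupp.toMultiset_sum, Fintype.sum_sum_type]
    simp
  rw [hτ]
  refine degrees_det_le_sum _ _ fun i j => ?_
  rcases i with i | i <;> rcases j with j | j
  · simp [degrees_C]
  · simp only [fromBlocks_apply₁₂, Matrix.neg_apply, blockVar, Matrix.mul_diagonal,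
      Matrix.map_apply, Sum.elim_inr, degrees_neg]
    exact degrees_mul_le.trans (by simp [degrees_C])
  · simp [degrees_C]
  · simp only [fromBlocks_apply₂₂, Matrix.sub_apply, blockVar, Matrix.mul_diagonal,
      Matrix.map_apply, Sum.elim_inr]
    refine degrees_sub_le.trans (sup_le ?_ ?_)
    · rw [Matrix.one_apply]
      split_ifs <;> simp
    · exact degrees_mul_le.trans (by simp [degrees_C])

/-- `s(0) = det(I − D Z_m)|_{z=0} = 1` [GKVW, proof of Thm. 5.6]: the constant coefficient of
`det(I − K Z_n)` is `1`. [cite: GrinshpanKaliuzhnyiverbovetsWoerdeman2012, proof of Thm. 5.6] -/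
theorem constantCoeff_gkvwDet (κ : Fin R → σ) (K : Matrix (Fin R) (Fin R) ℂ) :
    constantCoeff (gkvwDet κ K) = 1 := by
  have hmap : (1 - K.map (C : ℂ → MvPolynomial σ ℂ) * blockVar κ).map constantCoeff = 1 := by
    ext i j
    simp [blockVar, Matrix.mul_diagonal, Matrix.one_apply]
  rw [gkvwDet, RingHom.map_det, RingHom.mapMatrix_apply, hmap, det_one]

/-- `det(I − K Z_n) ≠ 0`. [folklore] -/
theorem gkvwDet_ne_zero (κ : Fin R → σ) (K : Matrix (Fin R) (Fin R) ℂ) : gkvwDet κ K ≠ 0 := by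
  intro h
  have := constantCoeff_gkvwDet κ K
  rw [h, map_zero] at this
  exact zero_ne_one this

/-- **Step 1 of the proof of [GKVW, Thm. 5.6]**: "taking the determinant of both sides of
`num/den = A + B Z_m (I − D Z_m)⁻¹ C` and using Lemma 2.2" gives
`num · s = den · r` with `s = det(I − D Z_m)` and `r = det [[A, −B Z_m], [C, I − D Z_m]]`.
[cite: GrinshpanKaliuzhnyiverbovetsWoerdeman2012, proof of Thm. 5.6] -/
theorem IsRealizedBy.mul_gkvwDet_eq {κ : Fin R → σ}
    {U : Matrix (Fin 1 ⊕ Fin R) (Fin 1 ⊕ Fin R) ℂ} {num den : MvPolynomial σ ℂ}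
    (h : IsRealizedBy κ U num den) :
    num * gkvwDet κ U.toBlocks₂₂ =
      den * (fromBlocks ((U.toBlocks₁₁).map C) (-((U.toBlocks₁₂).map C * blockVar κ))
        ((U.toBlocks₂₁).map C) (1 - (U.toBlocks₂₂).map C * blockVar κ)).det := by
  have hq : (1 - (U.toBlocks₂₂).map (C : ℂ → MvPolynomial σ ℂ) * blockVar κ).det ≠ 0 :=
    gkvwDet_ne_zero κ U.toBlocks₂₂
  have hA := det_fromBlocks_mul_det ((U.toBlocks₁₁).map C) (-((U.toBlocks₁₂).map C * blockVar κ))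
    ((U.toBlocks₂₁).map C) (1 - (U.toBlocks₂₂).map (C : ℂ → MvPolynomial σ ℂ) * blockVar κ)
  rw [Matrix.neg_mul, Matrix.neg_mul, Matrix.neg_apply, sub_neg_eq_add] at hA
  have hN := mul_right_cancel₀ hq hA
  rw [hN]
  exact h

/-- **Step 5 of the proof of [GKVW, Thm. 5.6]** ("`K = D`" is a contraction): the `(2,2)` corner
`D` of a unitary `U = [[A, B], [C, D]]` has operator norm `≤ 1` on `ℓ²`, since
`‖D x‖ ≤ ‖U (0 ⊕ x)‖ = ‖x‖`. [folklore] -/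
theorem isContraction_toBlocks₂₂ {U : Matrix (Fin 1 ⊕ Fin R) (Fin 1 ⊕ Fin R) ℂ}
    (hU : U ∈ Matrix.unitaryGroup (Fin 1 ⊕ Fin R) ℂ) : IsContraction U.toBlocks₂₂ := by
  rw [IsContraction]
  refine ContinuousLinearMap.opNorm_le_bound _ zero_le_one fun x => ?_
  rw [one_mul]
  set y : EuclideanSpace ℂ (Fin 1 ⊕ Fin R) :=
    WithLp.toLp 2 (Sum.elim (0 : Fin 1 → ℂ) (WithLp.ofLp x)) with hy
  have hu : Matrix.toEuclideanCLM (n := Fin 1 ⊕ Fin R) (𝕜 := ℂ) U ∈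
      unitary (EuclideanSpace ℂ (Fin 1 ⊕ Fin R) →L[ℂ] EuclideanSpace ℂ (Fin 1 ⊕ Fin R)) :=
    Unitary.map_mem _ hU
  have hnorm : ‖Matrix.toEuclideanCLM (n := Fin 1 ⊕ Fin R) (𝕜 := ℂ) U y‖ = ‖y‖ :=
    ContinuousLinearMap.norm_map_of_mem_unitary hu y
  have hy_norm : ‖y‖ = ‖x‖ := by
    rw [← sq_eq_sq₀ (norm_nonneg _) (norm_nonneg _), EuclideanSpace.norm_sq_eq,
      EuclideanSpace.norm_sq_eq, Fintype.sum_sum_type]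
    simp [hy]
  have hcoord : ∀ i, (Matrix.toEuclideanCLM (n := Fin 1 ⊕ Fin R) (𝕜 := ℂ) U y) (Sum.inr i) =
      (Matrix.toEuclideanCLM (n := Fin R) (𝕜 := ℂ) U.toBlocks₂₂ x) i := by
    intro i
    simp [hy, Matrix.mulVec, dotProduct, Fintype.sum_sum_type, Matrix.toBlocks₂₂]
  have key : ‖Matrix.toEuclideanCLM (n := Fin R) (𝕜 := ℂ) U.toBlocks₂₂ x‖ ^ 2 ≤
      ‖Matrix.toEuclideanCLM (n := Fin 1 ⊕ Fin R) (𝕜 := ℂ) U y‖ ^ 2 := by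
    rw [EuclideanSpace.norm_sq_eq, EuclideanSpace.norm_sq_eq, Fintype.sum_sum_type]
    simp_rw [hcoord]
    exact le_add_of_nonneg_left (Finset.sum_nonneg fun _ _ => sq_nonneg _)
  calc ‖Matrix.toEuclideanCLM (n := Fin R) (𝕜 := ℂ) U.toBlocks₂₂ x‖
      ≤ ‖Matrix.toEuclideanCLM (n := Fin 1 ⊕ Fin R) (𝕜 := ℂ) U y‖ :=
        le_of_pow_le_pow_left₀ two_ne_zero (norm_nonneg _) key
    _ = ‖x‖ := by rw [hnorm, hy_norm]

/-! ### The reflection `z^m p̄(1/z)` -/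

/-- `deg (z^n p̄(1/z)) ≤ n`. [folklore] -/
theorem degrees_conjReverse_le [DecidableEq σ] (n : σ →₀ ℕ) (p : MvPolynomial σ ℂ) :
    (conjReverse n p).degrees ≤ Finsupp.toMultiset n := by
  unfold conjReverse
  refine (degrees_sum_le _ _).trans (Finset.sup_le fun α _ => ?_)
  exact (degrees_monomial _ _).trans (toMultiset_le_toMultiset.mpr tsub_le_self)

/-- The coefficient of `z^n` in `z^n p̄(1/z)` is `conj p(0)` (for `deg p ≤ n`). [folklore] -/
theorem coeff_conjReverse_self [DecidableEq σ] {n : σ →₀ ℕ} {p : MvPolynomial σ ℂ}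
    (h : ∀ α ∈ p.support, α ≤ n) :
    coeff n (conjReverse n p) = starRingEnd ℂ (coeff 0 p) := by
  unfold conjReverse
  rw [coeff_sum]
  simp_rw [coeff_monomial]
  rw [Finset.sum_eq_single (0 : σ →₀ ℕ)]
  · simp
  · intro α hα hα0
    rw [if_neg]
    intro hn
    apply hα0
    have hle := h α hα
    have : n - α + α = n + α := by rw [hn]
    rw [tsub_add_cancel_of_le hle] at this
    exact (add_eq_left.mp this.symm)
  · intro h0
    simp [notMem_support_iff.mp h0]

/-- `z^m p̄(1/z) = z^{m−n} · z^n p̄(1/z)` for `deg p ≤ n ≤ m`. [folklore] -/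
theorem conjReverse_eq_monomial_mul {n m : σ →₀ ℕ} (hnm : n ≤ m) {p : MvPolynomial σ ℂ}
    (h : ∀ α ∈ p.support, α ≤ n) :
    conjReverse m p = monomial (m - n) 1 * conjReverse n p := by
  unfold conjReverse
  rw [Finset.mul_sum]
  refine Finset.sum_congr rfl fun α hα => ?_
  rw [monomial_mul, one_mul, tsub_add_tsub_cancel hnm (h α hα)]

/-- Every exponent of `p` is `≤ deg p` componentwise. [folklore] -/
theorem le_multiDegree_of_mem_support [DecidableEq σ] {p : MvPolynomial σ ℂ} {α : σ →₀ ℕ}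
    (hα : α ∈ p.support) : α ≤ multiDegree p := fun i => by
  rw [multiDegree_apply]; exact monomial_le_degreeOf i hα

/-- If every exponent of `p` is `≤ m`, then `deg p ≤ m`. [folklore] -/
theorem multiDegree_le_of_support [DecidableEq σ] {p : MvPolynomial σ ℂ} {m : σ →₀ ℕ}
    (h : ∀ α ∈ p.support, α ≤ m) : multiDegree p ≤ m := fun i => by
  rw [multiDegree_apply, degreeOf_le_iff]; exact fun α hα => h α hα i

/-! ### Theorem 5.6 -/

/-- **[GKVW, Theorem 5.6], proved** — discharging the named fact `GKVW2012_thm_5_6`, following the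
published proof (p. 10–11): (1) by Lemma 2.2, `z^m p̄(1/z) · s = p · r` with `s = det(I − D Z_m)`,
`r = det [[A, −B Z_m], [C, I − D Z_m]]`, both of multidegree `≤ m`; (2) `p` scattering Schur with
`p(0) = 1` is coprime to `z^m p̄(1/z) = z^{m − deg p} · z^{deg p} p̄(1/z)`, so `p ∣ s`, `s = q p`;
(3) `z^m p̄(1/z) · q = r` and `deg (z^m p̄(1/z)) = m` (its `z^m`-coefficient is `conj p(0) = 1`)
force `deg q = 0`, and `p(0) = s(0) = 1` force `q = 1`; (4) `K = D` is a contraction as a corner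
of the unitary `U`. [cite: GrinshpanKaliuzhnyiverbovetsWoerdeman2012, Thm. 5.6] -/
theorem GKVW2012_thm_5_6_holds : GKVW2012_thm_5_6 := by
  intro d R p κ hSS h0 hdeg hreal
  obtain ⟨U, hU, hreal⟩ := hreal
  refine ⟨U.toBlocks₂₂, isContraction_toBlocks₂₂ hU, ?_⟩
  -- constant coefficients: `p(0) = 1`, `s(0) = 1`
  have hp0 : constantCoeff p = 1 := by rwa [MvPolynomial.eval_zero] at h0
  have hp : p ≠ 0 := fun h => by simp [h] at hp0
  have hs0 : constantCoeff (gkvwDet κ U.toBlocks₂₂) = 1 := constantCoeff_gkvwDet κ _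
  -- Steps 1–2: `z^m p̄(1/z) · s = p · r` with `deg r ≤ m`
  obtain ⟨r, hr, h1⟩ : ∃ r : MvPolynomial (Fin d) ℂ,
      r.degrees ≤ Finsupp.toMultiset (blockOrder κ) ∧
        conjReverse (blockOrder κ) p * gkvwDet κ U.toBlocks₂₂ = p * r :=
    ⟨_, degrees_det_numMatrix_le κ U.toBlocks₁₁ U.toBlocks₁₂ U.toBlocks₂₁ U.toBlocks₂₂,
      hreal.mul_gkvwDet_eq⟩
  -- Step 3: `p ∣ s`
  have hn : multiDegree p ≤ blockOrder κ := multiDegree_le_of_support hdeg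
  have hsupp : ∀ α ∈ p.support, α ≤ multiDegree p := fun α hα => le_multiDegree_of_mem_support hα
  have hdvd : p ∣ gkvwDet κ U.toBlocks₂₂ := by
    have hdvd1 : p ∣ monomial (blockOrder κ - multiDegree p) (1 : ℂ) *
        (conjReverse (multiDegree p) p * gkvwDet κ U.toBlocks₂₂) :=
      ⟨r, by rw [← mul_assoc, ← conjReverse_eq_monomial_mul hn hsupp, h1]⟩
    obtain ⟨m', p', -, hp'dvd, hpp'⟩ := dvd_monomial_mul_iff_exists.mp hdvd1
    have hm' : m' = 0 := by
      by_contra hne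
      have := congrArg constantCoeff hpp'
      rw [map_mul, constantCoeff_monomial, if_neg hne, zero_mul, hp0] at this
      exact one_ne_zero this
    rw [hm', monomial_zero', C_1, one_mul] at hpp'
    rw [← hpp'] at hp'dvd
    exact hSS.2.dvd_of_dvd_mul_left hp'dvd
  obtain ⟨q, hsq⟩ := hdvd
  -- `q(0) = 1`
  have hq0 : constantCoeff q = 1 := by
    have := congrArg constantCoeff hsq
    rwa [hs0, map_mul, hp0, one_mul, eq_comm] at this
  have hq : q ≠ 0 := fun h => by simp [h] at hq0
  -- Step 4: `z^m p̄(1/z) · q = r`, degree count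
  have h2 : conjReverse (blockOrder κ) p * q = r := by
    refine mul_left_cancel₀ hp ?_
    rw [← h1, hsq]; ring
  have hcR : conjReverse (blockOrder κ) p ≠ 0 := by
    intro h
    have := coeff_conjReverse_self hdeg
    rw [h, coeff_zero, ← constantCoeff_eq, hp0, map_one] at this
    exact zero_ne_one this
  have hm_le : Finsupp.toMultiset (blockOrder κ) ≤ (conjReverse (blockOrder κ) p).degrees := by
    rw [degrees_def]
    refine Finset.le_sup (f := fun s : Fin d →₀ ℕ => Finsupp.toMultiset s) ?_
    rw [mem_support_iff, coeff_conjReverse_self hdeg, ← constantCoeff_eq, hp0, map_one]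
    exact one_ne_zero
  have hdegq : q.degrees = 0 := by
    have := degrees_mul_eq hcR hq
    rw [h2] at this
    have h3 : Finsupp.toMultiset (blockOrder κ) + q.degrees ≤ Finsupp.toMultiset (blockOrder κ) + 0 := by
      rw [add_zero]
      exact (add_le_add hm_le le_rfl).trans (this ▸ hr)
    exact Multiset.le_zero.1 (le_of_add_le_add_left h3)
  have hq1 : q = 1 := by
    have htot : q.totalDegree = 0 := by
      have := totalDegree_le_degrees_card q
      rw [hdegq, Multiset.card_zero] at this
      exact Nat.le_zero.1 this
    rw [totalDegree_eq_zero_iff_eq_C, ← constantCoeff_eq, hq0, C_1] at htot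
    exact htot
  rw [hsq, hq1, mul_one]

end Literature.Analysis.OperatorTheory

end
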